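import Summits.NavierStokesRegularity.NavierStokesRegularity.Theses.DulacContraction
import Summits.NavierStokesRegularity.NavierStokesRegularity.Theorems.SymmetryModuliCountForcedSymmetryRdssLiouvilleTauReduction
import HarnessLib.Audit

/-!
# Birth skeleton (BC3) of the crux `DulacContraction.RDSSLiouvilleInClass`

(crux item `stmt-NavierStokesRegularity-8561`, rank 4, route `route-NavierStokesRegularity-DulacContraction`
(shared BY NAME as `stub_rdssLiouville` of the line `recurrent-closing` of crux `ForcedSymmetry`, stmt-4052);
tree path `Cruxes/RDSSLiouvilleInClass/Lines/birth.lean`; registrar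
`planner-skel-stmt-NavierStokesRegularity-8561-0`, 2026-08-17. The route predates the Lean birth certificate;
this file supplies BC3 retroactively.)

THE CRUX (fixed, the route's decl). A smooth profile `(w, q, H)` of the Albritton–Barker local-energy
Type-I class `𝒦_C` on the slab `ℝ³ × (−∞,0)` — `(w,q)` suitable weak (`ν = 1`, `f = 0`), weak spatial
gradient `H`, `𝐈 = typeIBound < ∞`, time rate `‖w(t,x)‖ ≤ C/√(−t)`, classical on `(−∞,0)` — which is
invariant a.e. on the slab under ONE similarity `(t,x) ↦ l • R⁻¹ w (l²t + τ) (l R x + ξ)` with `l > 1`,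
`R ∈ O(3)`, `τ ≤ 0`, is REGULAR at the space–time origin (`¬ IsBackwardSingularPoint w 0`). The centre of the
similarity is `(t*, x*)`, `t* = −τ/(l²−1) ≥ 0`, `x* = l R x* + ξ`.

WHAT THE TREE ALREADY HAS (used, not stubbed).
`Theorems.SymmetryModuliCountForcedSymmetry.rdssLiouvilleInClass_iff_centreTimeZero` (landed p138494): the
case `τ < 0` (`t* > 0`) is ELEMENTARY from the time rate alone, so the crux is EQUIVALENT to its `τ = 0` core
(centre on the final slice). The composition below starts with this rewrite; everything that follows concerns
`τ = 0`.

THE CUT — the printed anatomy of the self-similar wall, typed in the class (route header: "RDSSLiouvilleInClass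
⇐ DSSAllFactors → RSSAllRates → OffCentreRegularity"; lead c3 of crux 4052, STATUS 2026-08-17: "remaining gaps
to the printed rungs are … (iii) time-decay + 𝐈<∞ ⇒ space–time decay (Chae–Wolf Thm 1.1 analogue in the
local-energy class)"). For a `τ = 0` profile the final slice carries the spatial centre `x*` (the unique fixed
point of `x ↦ l R x + ξ`) and, possibly, SATELLITES: further singular points `(0, y)`, `y ≠ x*`, which the
similarity forces to come in whole orbits `x* + (lR)^{-k}(y − x*)` accumulating at the centre. The crux is
exactly "no satellites" ∧ "no singular centre":

* `stub_satelliteExclusion` [L; OPEN LEMMA — gap (iii) proper] — a `τ = 0` profile of the class is regular at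
  every point `(0, y)` of the final slice with `y ≠ l R y + ξ` (i.e. `y ≠ x*`). Chae–Wolf 2017 Thm 1.1
  (arXiv:1610.09464) proves this for `λ`-DSS solutions in `C((−∞,0); Lᵖ) ∩ C^∞`, `3 ≤ p < ∞`; in `𝒦_C` it is
  NOT in print: `𝐈 < ∞` bounds `A, C, D, E` at every scale and centre but gives no smallness, and for a
  DISCRETE factor the lid orbit `{x* + (lR)^{-k}v}` is `𝓗¹`-null, so CKN partial regularity does not exclude
  it (drefute g3 on crux 4052, `NegativeNotes-stub_futureVertexLiouvilleRotated-g3.md`: the self-improvement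
  works for the CONTINUOUS spiral group only; 1589's card `satellite-exclusion-dark-profiles`). Why it might
  fail: one Type-I RDSS profile carrying a singular satellite orbit on its final slice. (Such a profile is also
  singular at its centre — a centre-regular RDSS profile vanishes identically by iterating the similarity — so
  this witness kills the crux too, but NOT `stub_centredWall`, whose decay hypothesis it violates.)
* `stub_decayOfSatelliteFree` [M; KNOWN TYPE, provable now — Chae–Wolf's scaling step, no Navier–Stokes input]
  — a classical profile with the time rate, RDSS about the ORIGIN (`τ = 0`, `ξ = 0`) a.e. on the slab, all of
  whose final-slice points `y ≠ l R y` (i.e. `y ≠ 0`) are regular, has SPACE–time Type-I decay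
  `‖w(t,x)‖ ≤ C₀/(‖x‖ + √(−t))` (`HasTypeIDecay C₀ w`). Proof sketch: a.e. ⇒ pointwise invariance on `t < 0`
  (tree: `rdssInvariant_pointwise_of_classical`); continuity + regularity of every `(0,y)`, `1 ≤ ‖y‖ ≤ l`,
  + compactness of that annulus give `‖w‖ ≤ M` on `(−δ², 0) × {1 ≤ ‖x‖ ≤ l}`; iterate the similarity:
  `‖w(t,x)‖ ≤ l M/‖x‖` where `‖x‖ > (l/δ)√(−t)`, and `‖w‖ ≤ C/√(−t)` elsewhere; both are
  `≤ C₀/(‖x‖ + √(−t))`.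
* `stub_centredWall` [OPEN PROBLEM, named — the wall proper] — a profile of the class, RDSS about the origin
  a.e. on the slab (`τ = 0`, `ξ = 0`), WITH space–time decay `HasTypeIDecay C₀ w`, is regular at the origin.
  This is Bradshaw–Tsai 2017 OP 5.1 = Tsai 2018 Conj. 8.8 (every `λ > 1`) and 8.9 (every rotation) =
  Pineau–Vicol 2026 Conj. 1.1, transported into `𝒦_C ∩ C^∞`: it is implied by the canonical conjecture
  `Summit.NavierStokesRegularity.NavierStokesRegularity.TypeIDSSLiouvilleConjecture`
  (`∀ λ R, RotatedTypeIDSSLiouville λ R`: ancient mild, measurable slices, `IsRotatedDSS`, `HasTypeIDecay`)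
  through the class bridge `𝒦 ⊂` ancient-mild a.e. (tree: `exists_isTypeIAncientMild_repr_of_slabProfile`,
  `…ClassEquivalence.lean`) + pointwise invariance + truncation at `t ≥ 0` — a `--supports` lemma anyone may
  land. Proved rungs (all under the decay hypothesis this stub carries): SS (NRŠ 1996, Tsai 1998; tree),
  `1 < λ < λ_*(C₀)` (Chae–Wolf 2017 Thm 1.3; Pineau–Vicol Thms 1.6–1.7, tree `pineauVicol2026_rdss_liouville`),
  RSS at extreme `α` (Pineau–Vicol Thm 1.4, tree `pineauVicol2026_rss_liouville`). Open: `λ ≥ λ_*`, `α ≈ 1`,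
  genuinely rotated DSS. Why it might fail: one decaying Type-I (R)DSS profile (route Blowup's stmt-0155; cards
  quarter-turn-rdss-funnel, corkscrew-dynamo-bootstrap-dss).

COMPOSITION. `RDSSLiouvilleInClass_of : Sig.stub_satelliteExclusion → Sig.stub_decayOfSatelliteFree →
Sig.stub_centredWall → RDSSLiouvilleInClass` (the statements `Sig.stub_*` are the three stub signatures as named
`Prop`s, so that the composition's hypotheses are the declared stubs BY NAME) is the REAL proof, closed (no
`sorry` of its own): rewrite with the tree's `τ = 0` reduction; if `ξ ≠ 0` the origin is not the centre
(`0 ≠ l R 0 + ξ`), so it is a regular satellite point (stub 1); if `ξ = 0`, stub 1 clears every `y ≠ 0`,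
stub 2 turns that into space–time decay, and stub 3 removes the centre. `RDSSLiouvilleInClass_proof :
RDSSLiouvilleInClass := RDSSLiouvilleInClass_of stub_… stub_… stub_…` is the by-name form carrying exactly the
three registered placeholders. So, modulo the landed `τ`-reduction and the provable stub 2, the crux is
LITERALLY `stub_satelliteExclusion ∧ stub_centredWall`, two statements with disjoint refutation witnesses
(satellite-carrying profile / decaying centre-singular profile).

`lean check --json` (registrar folder copy `bc/RDSSLiouvilleInClass_birth.lean`): rc 0, sorries = 3 = the three
`stub_*` (one `declaration uses 'sorry'` warning each), zero elsewhere. BC3 PROBES (`bc/probe_*.lean`): for each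
stub `S`, `S → RDSSLiouvilleInClass` and `S → NavierStokesRegularity` by
`first | exact? | simpa | aesop` FAIL (6/6; outputs quoted in `Lines/birth.md`) — no stub is cheaply the crux
or the summit.

Disproof used: none exists for this crux (`ledger crux ls stmt-NavierStokesRegularity-8561`: no workfiles before
this one — no `Disproof.lean`, no `Negative/` lemma, no dead line; 2026-08-17). Negatives index of the summit
consulted: no refuted statement concerns (R)DSS profiles of the local-energy class, satellite points or the
Type-I DSS Liouville wall; no stub is an instance of a refuted statement. Nearest in-tree statements
deliberately NOT restated as stubs: the canonical `TypeIDSSLiouvilleConjecture` itself (kept one bridge away, see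
stub 3 — the bridge is known-type and would only add a bookkeeping stub), `chaeWolf2017_dss_typeI_decay`
(`C_t Lᵖ` class — the model of stubs 1–2, not a drop-in: the class here has `𝐈 < ∞` and the time rate only).
-/

noncomputable section

open MeasureTheory Set Function
open scoped ENNReal
open Literature.Analysis.FluidPDE

namespace Summit.NavierStokesRegularity.NavierStokesRegularity.Cruxes.RDSSLiouvilleInClass.Birth

set_option linter.unusedVariables false
set_option linter.dupNamespace false

local notation "ℝ³" => EuclideanSpace ℝ (Fin 3)

/-! ### The three stub statements as named propositions (hypothesis heads of the composition) -/

/-- Statement of stub 1 (`stub_satelliteExclusion`): a final-slice-centred (`τ = 0`) RDSS profile of the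
class is regular at every non-centre point `(0, y)`, `y ≠ l R y + ξ`, of the final slice. -/
def Sig.stub_satelliteExclusion : Prop :=
  ∀ (w : ℝ → ℝ³ → ℝ³) (q : ℝ → ℝ³ → ℝ) (H : ℝ → ℝ³ → ℝ³ →L[ℝ] ℝ³) (C : ℝ),
    IsSuitableWeakSolutionOn (slab ℝ³ (Set.Iio 0) isOpen_Iio) 1 0 w q →
    HasWeakSpatialGradientOn (slab ℝ³ (Set.Iio 0) isOpen_Iio) w H →
    typeIBound (Set.Iio (0 : ℝ) ×ˢ Set.univ) w q H < ⊤ →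
    HasTypeITimeDecay C w →
    IsClassicalNSSolutionOn (Set.Iio 0) 1 0 w q →
    ∀ (l : ℝ) (R : ℝ³ ≃ₗᵢ[ℝ] ℝ³) (ξ : ℝ³), 1 < l →
      (fun z : ℝ × ℝ³ => l • R.symm (w (l ^ 2 * z.1) (l • R z.2 + ξ)))
        =ᵐ[volume.restrict (Set.Iio (0 : ℝ) ×ˢ Set.univ)] (fun z : ℝ × ℝ³ => w z.1 z.2) →
      ∀ y : ℝ³, y ≠ l • R y + ξ → ¬ IsBackwardSingularPoint w ((0 : ℝ), y)

/-- Statement of stub 2 (`stub_decayOfSatelliteFree`): for a classical Type-I-rate profile, RDSS about the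
origin a.e. on the slab, regularity of every final-slice point `y ≠ l R y` (every `y ≠ 0`) upgrades the time
rate to SPACE–time Type-I decay. -/
def Sig.stub_decayOfSatelliteFree : Prop :=
  ∀ (w : ℝ → ℝ³ → ℝ³) (q : ℝ → ℝ³ → ℝ) (C : ℝ),
    HasTypeITimeDecay C w →
    IsClassicalNSSolutionOn (Set.Iio 0) 1 0 w q →
    ∀ (l : ℝ) (R : ℝ³ ≃ₗᵢ[ℝ] ℝ³), 1 < l →
      (fun z : ℝ × ℝ³ => l • R.symm (w (l ^ 2 * z.1) (l • R z.2)))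
        =ᵐ[volume.restrict (Set.Iio (0 : ℝ) ×ˢ Set.univ)] (fun z : ℝ × ℝ³ => w z.1 z.2) →
      (∀ y : ℝ³, y ≠ l • R y → ¬ IsBackwardSingularPoint w ((0 : ℝ), y)) →
      ∃ C₀ : ℝ, HasTypeIDecay C₀ w

/-- Statement of stub 3 (`stub_centredWall`): the Type-I RDSS Liouville wall at the centre, in the class —
an origin-centred RDSS profile of the class WITH space–time decay is regular at the origin
(Bradshaw–Tsai 2017 OP 5.1; Tsai 2018 Conj. 8.8–8.9; Pineau–Vicol 2026 Conj. 1.1). -/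
def Sig.stub_centredWall : Prop :=
  ∀ (w : ℝ → ℝ³ → ℝ³) (q : ℝ → ℝ³ → ℝ) (H : ℝ → ℝ³ → ℝ³ →L[ℝ] ℝ³) (C : ℝ),
    IsSuitableWeakSolutionOn (slab ℝ³ (Set.Iio 0) isOpen_Iio) 1 0 w q →
    HasWeakSpatialGradientOn (slab ℝ³ (Set.Iio 0) isOpen_Iio) w H →
    typeIBound (Set.Iio (0 : ℝ) ×ˢ Set.univ) w q H < ⊤ →
    HasTypeITimeDecay C w →
    IsClassicalNSSolutionOn (Set.Iio 0) 1 0 w q →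
    ∀ (l : ℝ) (R : ℝ³ ≃ₗᵢ[ℝ] ℝ³), 1 < l →
      (fun z : ℝ × ℝ³ => l • R.symm (w (l ^ 2 * z.1) (l • R z.2)))
        =ᵐ[volume.restrict (Set.Iio (0 : ℝ) ×ˢ Set.univ)] (fun z : ℝ × ℝ³ => w z.1 z.2) →
      (∃ C₀ : ℝ, HasTypeIDecay C₀ w) →
      ¬ IsBackwardSingularPoint w 0

/-! ### The stubs (the ONLY sorries of this file) -/

/-- **stub 1 — `stub_satelliteExclusion` (L; OPEN LEMMA, gap (iii) of the printed rungs).** For every smooth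
profile `(w, q, H)` of `𝒦_C` (suitable weak on the slab, weak gradient, `𝐈 < ∞`, time rate `C`, classical on
`(−∞,0)`) invariant a.e. on the slab under `(t,x) ↦ l • R⁻¹ w (l²t) (l R x + ξ)`, `l > 1` (centre on the final
slice), every point `(0, y)` with `y ≠ l R y + ξ` — i.e. every final-slice point other than the spatial centre
`x*` — is NOT a backward singular point. Model: Chae–Wolf 2017 Thm 1.1 (arXiv:1610.09464; `C_t Lᵖ`,
`3 ≤ p < ∞`). Why it might fail: a Type-I RDSS profile with a singular satellite orbit
`x* + (lR)^{-k}(y − x*)` on its final slice — not excluded by CKN for a discrete factor (the orbit is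
`𝓗¹`-null) nor by `𝐈 < ∞` (bounds, not smallness). -/
theorem stub_satelliteExclusion :
    ∀ (w : ℝ → ℝ³ → ℝ³) (q : ℝ → ℝ³ → ℝ) (H : ℝ → ℝ³ → ℝ³ →L[ℝ] ℝ³) (C : ℝ),
      IsSuitableWeakSolutionOn (slab ℝ³ (Set.Iio 0) isOpen_Iio) 1 0 w q →
      HasWeakSpatialGradientOn (slab ℝ³ (Set.Iio 0) isOpen_Iio) w H →
      typeIBound (Set.Iio (0 : ℝ) ×ˢ Set.univ) w q H < ⊤ →
      HasTypeITimeDecay C w →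
      IsClassicalNSSolutionOn (Set.Iio 0) 1 0 w q →
      ∀ (l : ℝ) (R : ℝ³ ≃ₗᵢ[ℝ] ℝ³) (ξ : ℝ³), 1 < l →
        (fun z : ℝ × ℝ³ => l • R.symm (w (l ^ 2 * z.1) (l • R z.2 + ξ)))
          =ᵐ[volume.restrict (Set.Iio (0 : ℝ) ×ˢ Set.univ)] (fun z : ℝ × ℝ³ => w z.1 z.2) →
        ∀ y : ℝ³, y ≠ l • R y + ξ → ¬ IsBackwardSingularPoint w ((0 : ℝ), y) := by
  sorry

/-- **stub 2 — `stub_decayOfSatelliteFree` (M; KNOWN TYPE, provable now: scaling + compactness, no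
Navier–Stokes input).** A classical profile on `(−∞,0)` with the time rate `‖w(t,x)‖ ≤ C/√(−t)`, RDSS about
the origin a.e. on the slab (`(t,x) ↦ l • R⁻¹ w (l²t) (l R x)`, `l > 1`), all of whose final-slice points
`y ≠ l R y` (equivalently `y ≠ 0`) are regular, obeys `‖w(t,x)‖ ≤ C₀/(‖x‖ + √(−t))` for `t < 0`
(`HasTypeIDecay C₀ w`) for some `C₀`. (Pointwise invariance on `t < 0`:
`Theorems.SymmetryModuliCountForcedSymmetry.rdssInvariant_pointwise_of_classical`; bound `M` on
`(−δ²,0) × {1 ≤ ‖x‖ ≤ l}` by compactness; iterate the similarity where `‖x‖ > (l/δ)√(−t)`, use the time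
rate elsewhere.) Chae–Wolf 2017, proof of Thm 1.1, estimate (1.5). -/
theorem stub_decayOfSatelliteFree :
    ∀ (w : ℝ → ℝ³ → ℝ³) (q : ℝ → ℝ³ → ℝ) (C : ℝ),
      HasTypeITimeDecay C w →
      IsClassicalNSSolutionOn (Set.Iio 0) 1 0 w q →
      ∀ (l : ℝ) (R : ℝ³ ≃ₗᵢ[ℝ] ℝ³), 1 < l →
        (fun z : ℝ × ℝ³ => l • R.symm (w (l ^ 2 * z.1) (l • R z.2)))
          =ᵐ[volume.restrict (Set.Iio (0 : ℝ) ×ˢ Set.univ)] (fun z : ℝ × ℝ³ => w z.1 z.2) →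
        (∀ y : ℝ³, y ≠ l • R y → ¬ IsBackwardSingularPoint w ((0 : ℝ), y)) →
        ∃ C₀ : ℝ, HasTypeIDecay C₀ w := by
  sorry

/-- **stub 3 — `stub_centredWall` (OPEN PROBLEM, named: Bradshaw–Tsai 2017 OP 5.1, Tsai 2018 Conj. 8.8–8.9,
Pineau–Vicol 2026 Conj. 1.1, in the class `𝒦_C ∩ C^∞`).** A smooth profile `(w, q, H)` of `𝒦_C`, RDSS about
the ORIGIN a.e. on the slab (`(t,x) ↦ l • R⁻¹ w (l²t) (l R x)`, `l > 1`, any `R ∈ O(3)`), WITH space–time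
Type-I decay `HasTypeIDecay C₀ w`, is regular at the origin (equivalently, vanishes: a centre-regular RDSS
profile is zero by iterating the similarity). Implied by the canonical
`Summit.NavierStokesRegularity.NavierStokesRegularity.TypeIDSSLiouvilleConjecture` via the known-type class
bridge (`exists_isTypeIAncientMild_repr_of_slabProfile` + pointwise invariance + truncation at `t ≥ 0`).
Proved rungs: SS; `1 < λ < λ_*(C₀)` (Chae–Wolf 2017 Thm 1.3, Pineau–Vicol Thms 1.6–1.7); RSS at extreme `α`
(Pineau–Vicol Thm 1.4). Why it might fail: one decaying backward Type-I (R)DSS profile. -/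
theorem stub_centredWall :
    ∀ (w : ℝ → ℝ³ → ℝ³) (q : ℝ → ℝ³ → ℝ) (H : ℝ → ℝ³ → ℝ³ →L[ℝ] ℝ³) (C : ℝ),
      IsSuitableWeakSolutionOn (slab ℝ³ (Set.Iio 0) isOpen_Iio) 1 0 w q →
      HasWeakSpatialGradientOn (slab ℝ³ (Set.Iio 0) isOpen_Iio) w H →
      typeIBound (Set.Iio (0 : ℝ) ×ˢ Set.univ) w q H < ⊤ →
      HasTypeITimeDecay C w →
      IsClassicalNSSolutionOn (Set.Iio 0) 1 0 w q →
      ∀ (l : ℝ) (R : ℝ³ ≃ₗᵢ[ℝ] ℝ³), 1 < l →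
        (fun z : ℝ × ℝ³ => l • R.symm (w (l ^ 2 * z.1) (l • R z.2)))
          =ᵐ[volume.restrict (Set.Iio (0 : ℝ) ×ˢ Set.univ)] (fun z : ℝ × ℝ³ => w z.1 z.2) →
        (∃ C₀ : ℝ, HasTypeIDecay C₀ w) →
        ¬ IsBackwardSingularPoint w 0 := by
  sorry

/-! ### Composition -/

/-- **Birth composition (kernel-checked, no sorry of its own).** The three stub STATEMENTS imply the crux
`DulacContraction.RDSSLiouvilleInClass` BY NAME. Reduce to `τ = 0` by the landed
`rdssLiouvilleInClass_iff_centreTimeZero`; if `ξ ≠ 0` the origin is a non-centre point of the final slice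
(`0 ≠ l R 0 + ξ`), regular by stub 1; if `ξ = 0`, stub 1 clears every `y ≠ l R y`, stub 2 gives space–time
decay, stub 3 removes the centre. -/
theorem RDSSLiouvilleInClass_of :
    Sig.stub_satelliteExclusion → Sig.stub_decayOfSatelliteFree → Sig.stub_centredWall →
    Summit.NavierStokesRegularity.NavierStokesRegularity.Theses.DulacContraction.RDSSLiouvilleInClass := by
  intro h1 h2 h3
  unfold Sig.stub_satelliteExclusion at h1
  unfold Sig.stub_decayOfSatelliteFree at h2
  unfold Sig.stub_centredWall at h3
  rw [Theorems.SymmetryModuliCountForcedSymmetry.rdssLiouvilleInClass_iff_centreTimeZero]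
  intro w q H C hsw hwg hI hdec hcl hinv
  obtain ⟨l, hl, R, ξ, hae⟩ := hinv
  by_cases hξ : ξ = 0
  · -- centre AT the origin: satellites (stub 1), decay (stub 2), wall (stub 3)
    subst hξ
    have hae0 : (fun z : ℝ × ℝ³ => l • R.symm (w (l ^ 2 * z.1) (l • R z.2)))
        =ᵐ[volume.restrict (Set.Iio (0 : ℝ) ×ˢ Set.univ)] (fun z : ℝ × ℝ³ => w z.1 z.2) := by
      simpa only [add_zero] using hae
    have hoff : ∀ y : ℝ³, y ≠ l • R y → ¬ IsBackwardSingularPoint w ((0 : ℝ), y) := by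
      intro y hy
      exact h1 w q H C hsw hwg hI hdec hcl l R 0 hl hae y (by simpa only [add_zero] using hy)
    obtain ⟨C₀, hC₀⟩ := h2 w q C hdec hcl l R hl hae0 hoff
    exact h3 w q H C hsw hwg hI hdec hcl l R hl hae0 ⟨C₀, hC₀⟩
  · -- centre `x* ≠ 0` on the final slice: the origin is a satellite point, regular by stub 1
    have h0 : (0 : ℝ³) ≠ l • R 0 + ξ := by
      intro h
      apply hξ
      have hz : l • R (0 : ℝ³) + ξ = ξ := by simp
      rw [hz] at h
      exact h.symm
    exact h1 w q H C hsw hwg hI hdec hcl l R ξ hl hae 0 h0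

/-- **The skeleton in by-name form**: the crux BY NAME modulo exactly the three registered stubs (this
theorem inherits their placeholders; `RDSSLiouvilleInClass_of` itself is closed). It is also the kernel check
that each stub's explicit signature is literally its `Sig` statement. -/
theorem RDSSLiouvilleInClass_proof :
    Summit.NavierStokesRegularity.NavierStokesRegularity.Theses.DulacContraction.RDSSLiouvilleInClass :=
  RDSSLiouvilleInClass_of stub_satelliteExclusion stub_decayOfSatelliteFree stub_centredWall

end Summit.NavierStokesRegularity.NavierStokesRegularity.Cruxes.RDSSLiouvilleInClass.Birth

end
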